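import Summits.QuantumFields.BalabanUV.Beta.FP.NestedStepLawTorusInstanceDelta
import Summits.QuantumFields.BalabanUV.Beta.FP.PeriodisedWardOrderZero
import Summits.QuantumFields.BalabanUV.Beta.FP.ComposedSliceGhostFactor

/-!
# `BalabanUV.Beta.FP.TorusOneShotInv` — road «FP» (binder row D1), ROUTE T row **(T-INV)** for the ONE-SHOT system:
# THE ONE-SHOT TWO-STEP COMPOSITE, COMB-SLICED ON THE BIG COMB, IS NON-DEGENERATE ON THE TORUS — UNCONDITIONALLY
# (`det kkt H₀ [Q₂₀·Q₁₀; P] ≠ 0`, the LEFT side of the torus call; the `h2` of a depth-3 call one level down)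

HONEST DEPENDENCY (page 1, mandatory): continuum YM on T⁴ ⇐ BetaPertH ∧ nine spine estimates (0/9 proved); BetaPertH ⇐ (D1) ∧ (D4) ∧
CAP+tail; G-an2-4 gates asym, D1 and NE2/3/4.  HONEST FRAMING (cell contract, verbatim): «discharging `BetaPertH` makes Bałaban's UV
stability UNCONDITIONAL — a real constructive-QFT result; it is NOT the continuum limit and NOT the Clay problem.»  ABSOLUTE RULE (cell
charter, verbatim): «No internally-minted statement may enter as a cited fact. Every hypothesis is either kernel-proved in this package or a
verbatim quotation of a PUBLISHED theorem with page reference. The manuscript(s) under audit are NOT citable for their own disputed steps — they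
are the thing under adjudication; programme-internal (2001/route/tribunal) claims are never citable.»  THIS MODULE is [folklore] composition BY NAME:
the OWNER's generic `ComposedSliceGhostFactor.det_kkt_oneShot_ne_zero` (the one-shot sliced determinant factorises through the two steps' sliced
determinants and the three Faddeev–Popov units, so it is non-zero when they are) fed with the torus letters already in the tree —
`NestedStepLawTorusInstance.torus_h1 ∕ torus_cov₁ ∕ torus_cov₂ ∕ torus_uni₁ ∕ torus_uni₂(_ne_zero) ∕ torus_uniP` (p313662),
`NestedStepLawTorusInstanceDelta.torus_cov₀'` (p316503), leaf-05's `RelInvPeriodisedEffFormCoarse.torus_h2_record` (p315453), and leaf-02 g18's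
`PeriodisedWardOrderZero.torus_H₀_mul_D₁ ∕ torus_H₀_mul_D₂ ∕ torus_H₀_transpose` (p317178).  No `Prop`, no `def`, nothing cited, 0 sorry.

CONTENT.  **`torus_h0`** — at the torus call's objects (p313662 ∕ p316503's `hH₀ hQ₁₀ hτ₁ hτ₂ hD₁ hD₂ hP` VERBATIM, the coarse one-step rows `hQ₂₀` on any
coarse-coarse presentation `(pμ′, inr mμ′)` with letters `hfμ′ hcoarse′`; `Lc ∣ M′ᵢ`, roots `r, r′ ∈ box`; every `j`):
`(kkt H₀ (fromRows (Q₂₀ * Q₁₀) P)).det ≠ 0`; **`torus_h0_named`** — the same with the composite rows NAMED (`h𝔔₀ : Q₂₀ * Q₁₀ = 𝔔₀`, the Delta's binder):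
`(kkt H₀ (fromRows 𝔔₀ P)).det ≠ 0` — i.e. the LEFT-HAND sliced system of the Delta's conclusion is a well-posed sliced Gaussian, no displayed letter.
WHY (leaf-05 g26): it is the (INV) letter a DEPTH-3 torus call would display for its coarse two-step block (the `h2` one level down), and the
order-0 companion of `CoarseJetUnit`'s self-similar reading.  WHAT IT IS NOT: NOT (T-ID), NOT SDF, NOT D1, NOT BetaPertH, NOT continuum, NOT Clay;
discharges NO binder of row D1 by itself; 0 estimates.  Unit `b2b-balaban-beta-d1-formalise-leaf-05` (gen 26), 2026-08-22.
-/

noncomputable section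

open scoped BigOperators Matrix

namespace Summit.QuantumFields.BalabanUV.Beta.FP.TorusOneShotInv

open Matrix Finset
open Literature.Probability.LatticeModels (Torus.proj)
open Literature.MathematicalPhysics.QuantumFieldTheory.Balaban1983to89
open Literature.MathematicalPhysics.QuantumFieldTheory.Balaban1983to89.Beta
open Literature.MathematicalPhysics.QuantumFieldTheory.Balaban1983to89.Beta.Composition (kkt)
open Literature.MathematicalPhysics.QuantumFieldTheory.Balaban1983to89.Beta.CompositionSingular (effForm)
open B5Prop11Plancherel (fine)
open B6Lemma24Torus (pbox)
open AffineAveraging (Site box toSite)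
open OneStepResolventKernel (Fib)
open Summit.QuantumFields.BalabanUV.Beta.BorderedHessian (bhKStepAt stepScale)
open Summit.QuantumFields.BalabanUV.Beta.FP.KernelPeriodisationFib (Idx perF)
open Summit.QuantumFields.BalabanUV.Beta.FP.TorusGaugeCovariance (tgrad)
open Summit.QuantumFields.BalabanUV.Beta.FP.TorusGaugeCovarianceCoarse (coarsePt tgradBlock coarsePt_coe)
open Summit.QuantumFields.BalabanUV.Beta.FP.TorusCombRows (Res combRowsT)
open Summit.QuantumFields.BalabanUV.Beta.FP.TorusCombNestedBasis (resBigEquiv)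
open Summit.QuantumFields.BalabanUV.Beta.FP.NestedStepLawTorusInstance (coarseSlot_injective coarseSlot_range torus_h1 torus_cov₁ torus_cov₂
  torus_uni₁ torus_uni₂ torus_uni₂_ne_zero torus_uniP)
open Summit.QuantumFields.BalabanUV.Beta.FP.NestedStepLawTorusInstanceDelta (torus_cov₀')
open Summit.QuantumFields.BalabanUV.Beta.FP.RelInvPeriodisedEffFormCoarse (torus_h2_record)
open Summit.QuantumFields.BalabanUV.Beta.FP.PeriodisedWardOrderZero (torus_H₀_mul_D₁ torus_H₀_mul_D₂ torus_H₀_transpose)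
open Summit.QuantumFields.BalabanUV.Beta.FP.ComposedSliceGhostFactor (det_kkt_oneShot_ne_zero)
open Summit.QuantumFields.BalabanUV.Beta.GAN24.FineReadoutCauchyFrame (toSite_mem_range)

variable {d : ℕ} (M' : Fin (d + 1) → ℕ) [∀ μ, NeZero (M' μ)] {Lc : ℕ} [NeZero Lc] {r r' : Fin (d + 1) → ℕ}

set_option synthInstance.maxSize 1024 in
/-- **[folklore] (T-INV) FOR THE ONE-SHOT TWO-STEP COMPOSITE ON THE TORUS, UNCONDITIONALLY.**  At the torus call's objects (`hH₀ hQ₁₀ hτ₁ hτ₂ hD₁ hD₂ hP`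
of p313662 ∕ p316503 VERBATIM; the coarse one-step rows `hQ₂₀` on any coarse-coarse multiplier presentation with letters `hfμ′ hcoarse′`):
`(kkt H₀ (fromRows (Q₂₀ * Q₁₀) P)).det ≠ 0` — the composite averaging `Q₂₀·Q₁₀` sliced by the BIG comb `P` borders the level-`j` periodised form
non-degenerately.  Proof = `det_kkt_oneShot_ne_zero` at `W₁ := D₁`, `W₂ := D₂` with the two-sided Ward letters (`torus_H₀_mul_D₁∕D₂`, `torus_H₀_transpose`),
the covariance letters (`torus_cov₁`, `torus_cov₂` + `torus_cov₀'`), the three Faddeev–Popov units (`torus_uni₁`, `torus_uni₂`, `torus_uniP`) and the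
two (INV) letters (`torus_h1`, `torus_h2_record`). -/
theorem torus_h0 (hr : r ∈ box (d + 1) Lc) (hr' : r' ∈ box (d + 1) Lc) (hM' : ∀ i, Lc ∣ M' i) (j : ℕ)
    {κ : Type*} [Fintype κ] [DecidableEq κ] (pμ' : κ → ↥(pbox M')) (mμ' : κ → Fin (d + 1))
    (hfμ' : Function.Injective (fun a : κ => ((pμ' a, Sum.inr (mμ' a)) : Idx M' (Fib d))))
    (hcoarse' : ∀ (s : ↥(pbox M')) (m : Fin (d + 1)),
      ((s, Sum.inr m) : Idx M' (Fib d)) ∈ Set.range (fun a : κ => ((pμ' a, Sum.inr (mμ' a)) : Idx M' (Fib d))) ↔ Torus.proj Lc (s : Site (d + 1)) = 0)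
    {H₀ : Matrix (↥(pbox (fine Lc M')) × Fin (d + 1)) (↥(pbox (fine Lc M')) × Fin (d + 1)) ℝ}
    {Q₁₀ : Matrix (↥(pbox M') × Fin (d + 1)) (↥(pbox (fine Lc M')) × Fin (d + 1)) ℝ}
    {τ₁ : Matrix (Res (toSite r) Lc (fine Lc M')) (↥(pbox (fine Lc M')) × Fin (d + 1)) ℝ}
    {τ₂ : Matrix (Res (toSite r') Lc M') (↥(pbox M') × Fin (d + 1)) ℝ}
    {D₁ : Matrix (↥(pbox (fine Lc M')) × Fin (d + 1)) (Res (toSite r) Lc (fine Lc M')) ℝ}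
    {D₂ : Matrix (↥(pbox (fine Lc M')) × Fin (d + 1)) (Res (toSite r') Lc M') ℝ}
    {P : Matrix (Res (toSite r') Lc M' ⊕ Res (toSite r) Lc (fine Lc M')) (↥(pbox (fine Lc M')) × Fin (d + 1)) ℝ}
    {Q₂₀ : Matrix κ (↥(pbox M') × Fin (d + 1)) ℝ}
    (hH₀ : H₀ = (perF (fine Lc M') (bhKStepAt d (toSite r) Lc j)).submatrix
        (fun b : ↥(pbox (fine Lc M')) × Fin (d + 1) => ((b.1, Sum.inl b.2) : Idx (fine Lc M') (Fib d)))
        (fun b : ↥(pbox (fine Lc M')) × Fin (d + 1) => ((b.1, Sum.inl b.2) : Idx (fine Lc M') (Fib d))))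
    (hQ₁₀ : Q₁₀ = (perF (fine Lc M') (bhKStepAt d (toSite r) Lc j)).submatrix
        (fun a : ↥(pbox M') × Fin (d + 1) => ((coarsePt M' Lc a.1, Sum.inr a.2) : Idx (fine Lc M') (Fib d)))
        (fun b : ↥(pbox (fine Lc M')) × Fin (d + 1) => ((b.1, Sum.inl b.2) : Idx (fine Lc M') (Fib d))))
    (hτ₁ : τ₁ = (combRowsT (toSite r) Lc (fine Lc M')).submatrix id
        (fun b : ↥(pbox (fine Lc M')) × Fin (d + 1) => ((b.1, Sum.inl b.2) : Idx (fine Lc M') (Fib d))))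
    (hτ₂ : τ₂ = (combRowsT (toSite r') Lc M').submatrix id (fun b : ↥(pbox M') × Fin (d + 1) => ((b.1, Sum.inl b.2) : Idx M' (Fib d))))
    (hD₁ : D₁ = (tgrad (fine Lc M')).submatrix (fun b : ↥(pbox (fine Lc M')) × Fin (d + 1) => ((b.1, Sum.inl b.2) : Idx (fine Lc M') (Fib d)))
        (Subtype.val : Res (toSite r) Lc (fine Lc M') → ↥(pbox (fine Lc M'))))
    (hD₂ : D₂ = (tgradBlock M' Lc).submatrix (fun b : ↥(pbox (fine Lc M')) × Fin (d + 1) => ((b.1, Sum.inl b.2) : Idx (fine Lc M') (Fib d)))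
        (Subtype.val : Res (toSite r') Lc M' → ↥(pbox M')))
    (hP : P = (combRowsT ((Lc : ℤ) • toSite r' + toSite r) (Lc * Lc) (fine Lc M')).submatrix
        (resBigEquiv Lc Lc (toSite r) (toSite r') M' (Nat.pos_of_ne_zero (NeZero.ne Lc)) (toSite_mem_range hr)
          (Nat.pos_of_ne_zero (NeZero.ne Lc)) (toSite_mem_range hr')).symm
        (fun b : ↥(pbox (fine Lc M')) × Fin (d + 1) => ((b.1, Sum.inl b.2) : Idx (fine Lc M') (Fib d))))
    (hQ₂₀ : Q₂₀ = (perF M' (bhKStepAt d (toSite r') Lc (j + 1))).submatrix (fun a : κ => ((pμ' a, Sum.inr (mμ' a)) : Idx M' (Fib d)))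
        (fun b : ↥(pbox M') × Fin (d + 1) => ((b.1, Sum.inl b.2) : Idx M' (Fib d)))) :
    (kkt H₀ (fromRows (Q₂₀ * Q₁₀) P)).det ≠ 0 := by
  -- the two-sided Ward letters of the fine form (leaf-02 g18, `Y₀ = Y'₀ = 0`)
  have hKW₁ : H₀ * D₁ = 0 := torus_H₀_mul_D₁ M' hr j hH₀ hD₁
  have hKW₂ : H₀ * D₂ = 0 := torus_H₀_mul_D₂ M' hr j hH₀ hD₂
  have hKtW₁ : H₀ᵀ * D₁ = 0 := by rw [torus_H₀_transpose M' j hH₀]; exact hKW₁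
  have hKtW₂ : H₀ᵀ * D₂ = 0 := by rw [torus_H₀_transpose M' j hH₀]; exact hKW₂
  -- the covariance letters: `Q₁₀·D₁ = 0`, `Q₁₀·D₂ = D̄`, `Q₂₀·D̄ = 0`
  have hQW₁ : Q₁₀ * D₁ = 0 := by rw [hQ₁₀, hD₁]; exact torus_cov₁ M' hr j
  have hDbar : Q₁₀ * D₂ = Matrix.of fun (a : ↥(pbox M') × Fin (d + 1)) (t : Res (toSite r') Lc M') =>
      stepScale d Lc j * (((box (d + 1) Lc).card : ℝ) * tgrad M' (a.1, Sum.inl a.2) t.1) := by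
    rw [hQ₁₀, hD₂]; exact torus_cov₂ M' hr j
  have hQQW₂ : Q₂₀ * (Q₁₀ * D₂) = 0 := by rw [hDbar, hQ₂₀]; exact torus_cov₀' M' hr' hM' j (j + 1) pμ' mμ'
  -- the three Faddeev–Popov units
  have hT : IsUnit (τ₁ * D₁).det := by
    rw [hτ₁, hD₁]
    exact isUnit_iff_ne_zero.2 (abs_ne_zero.1 (ne_of_eq_of_ne (torus_uni₁ M' hr) one_ne_zero))
  have hTc : IsUnit (τ₂ * (Q₁₀ * D₂)).det := by
    rw [hDbar, hτ₂]
    exact isUnit_iff_ne_zero.2 (abs_ne_zero.1 (ne_of_eq_of_ne (torus_uni₂ M' hr' hM' j) (torus_uni₂_ne_zero M' hr' j)))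
  have hS : IsUnit (P * fromCols D₂ D₁).det := by
    rw [hP, hD₂, hD₁]
    exact isUnit_iff_ne_zero.2 (abs_ne_zero.1 (ne_of_eq_of_ne (torus_uniP M' hr hr' hM') one_ne_zero))
  -- the two (INV) letters
  have h1 : IsUnit (kkt H₀ (fromRows Q₁₀ τ₁)).det := by
    rw [hH₀, hQ₁₀, hτ₁]; exact isUnit_iff_ne_zero.2 (torus_h1 M' hr j)
  have h2 : IsUnit (kkt (effForm H₀ (fromRows Q₁₀ τ₁)).toBlocks₁₁ (fromRows Q₂₀ τ₂)).det := by
    rw [hH₀, hQ₁₀, hτ₁, hQ₂₀, hτ₂]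
    exact isUnit_iff_ne_zero.2 (torus_h2_record M' hr j hr' hM' (coarsePt M' Lc) (coarsePt_coe M' Lc) (coarseSlot_injective M')
      (coarseSlot_range M') (fun a : κ => ((pμ' a, Sum.inr (mμ' a)) : Idx M' (Fib d))) hfμ' (fun a => ⟨mμ' a, rfl⟩) hcoarse')
  exact det_kkt_oneShot_ne_zero H₀ Q₁₀ τ₁ D₁ Q₂₀ τ₂ hKW₁ hKtW₁ hQW₁ hT h1 h2 D₂ hKW₂ hKtW₂ hQQW₂ hTc P hS

set_option synthInstance.maxSize 1024 in
/-- **[folklore] THE SAME WITH THE COMPOSITE ROWS NAMED** (the Delta's binder `h𝔔₀ : Q₂₀ * Q₁₀ = 𝔔₀`): `(kkt H₀ (fromRows 𝔔₀ P)).det ≠ 0` — the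
LEFT-HAND sliced system of `NestedStepLawTorusInstanceDelta.secondVar_oneShot_nestedStepLaw_torus_delta`'s conclusion is non-degenerate, no displayed letter. -/
theorem torus_h0_named (hr : r ∈ box (d + 1) Lc) (hr' : r' ∈ box (d + 1) Lc) (hM' : ∀ i, Lc ∣ M' i) (j : ℕ)
    {κ : Type*} [Fintype κ] [DecidableEq κ] (pμ' : κ → ↥(pbox M')) (mμ' : κ → Fin (d + 1))
    (hfμ' : Function.Injective (fun a : κ => ((pμ' a, Sum.inr (mμ' a)) : Idx M' (Fib d))))
    (hcoarse' : ∀ (s : ↥(pbox M')) (m : Fin (d + 1)),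
      ((s, Sum.inr m) : Idx M' (Fib d)) ∈ Set.range (fun a : κ => ((pμ' a, Sum.inr (mμ' a)) : Idx M' (Fib d))) ↔ Torus.proj Lc (s : Site (d + 1)) = 0)
    {H₀ : Matrix (↥(pbox (fine Lc M')) × Fin (d + 1)) (↥(pbox (fine Lc M')) × Fin (d + 1)) ℝ}
    {Q₁₀ : Matrix (↥(pbox M') × Fin (d + 1)) (↥(pbox (fine Lc M')) × Fin (d + 1)) ℝ}
    {τ₁ : Matrix (Res (toSite r) Lc (fine Lc M')) (↥(pbox (fine Lc M')) × Fin (d + 1)) ℝ}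
    {τ₂ : Matrix (Res (toSite r') Lc M') (↥(pbox M') × Fin (d + 1)) ℝ}
    {D₁ : Matrix (↥(pbox (fine Lc M')) × Fin (d + 1)) (Res (toSite r) Lc (fine Lc M')) ℝ}
    {D₂ : Matrix (↥(pbox (fine Lc M')) × Fin (d + 1)) (Res (toSite r') Lc M') ℝ}
    {P : Matrix (Res (toSite r') Lc M' ⊕ Res (toSite r) Lc (fine Lc M')) (↥(pbox (fine Lc M')) × Fin (d + 1)) ℝ}
    {Q₂₀ : Matrix κ (↥(pbox M') × Fin (d + 1)) ℝ}
    (hH₀ : H₀ = (perF (fine Lc M') (bhKStepAt d (toSite r) Lc j)).submatrix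
        (fun b : ↥(pbox (fine Lc M')) × Fin (d + 1) => ((b.1, Sum.inl b.2) : Idx (fine Lc M') (Fib d)))
        (fun b : ↥(pbox (fine Lc M')) × Fin (d + 1) => ((b.1, Sum.inl b.2) : Idx (fine Lc M') (Fib d))))
    (hQ₁₀ : Q₁₀ = (perF (fine Lc M') (bhKStepAt d (toSite r) Lc j)).submatrix
        (fun a : ↥(pbox M') × Fin (d + 1) => ((coarsePt M' Lc a.1, Sum.inr a.2) : Idx (fine Lc M') (Fib d)))
        (fun b : ↥(pbox (fine Lc M')) × Fin (d + 1) => ((b.1, Sum.inl b.2) : Idx (fine Lc M') (Fib d))))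
    (hτ₁ : τ₁ = (combRowsT (toSite r) Lc (fine Lc M')).submatrix id
        (fun b : ↥(pbox (fine Lc M')) × Fin (d + 1) => ((b.1, Sum.inl b.2) : Idx (fine Lc M') (Fib d))))
    (hτ₂ : τ₂ = (combRowsT (toSite r') Lc M').submatrix id (fun b : ↥(pbox M') × Fin (d + 1) => ((b.1, Sum.inl b.2) : Idx M' (Fib d))))
    (hD₁ : D₁ = (tgrad (fine Lc M')).submatrix (fun b : ↥(pbox (fine Lc M')) × Fin (d + 1) => ((b.1, Sum.inl b.2) : Idx (fine Lc M') (Fib d)))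
        (Subtype.val : Res (toSite r) Lc (fine Lc M') → ↥(pbox (fine Lc M'))))
    (hD₂ : D₂ = (tgradBlock M' Lc).submatrix (fun b : ↥(pbox (fine Lc M')) × Fin (d + 1) => ((b.1, Sum.inl b.2) : Idx (fine Lc M') (Fib d)))
        (Subtype.val : Res (toSite r') Lc M' → ↥(pbox M')))
    (hP : P = (combRowsT ((Lc : ℤ) • toSite r' + toSite r) (Lc * Lc) (fine Lc M')).submatrix
        (resBigEquiv Lc Lc (toSite r) (toSite r') M' (Nat.pos_of_ne_zero (NeZero.ne Lc)) (toSite_mem_range hr)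
          (Nat.pos_of_ne_zero (NeZero.ne Lc)) (toSite_mem_range hr')).symm
        (fun b : ↥(pbox (fine Lc M')) × Fin (d + 1) => ((b.1, Sum.inl b.2) : Idx (fine Lc M') (Fib d))))
    (hQ₂₀ : Q₂₀ = (perF M' (bhKStepAt d (toSite r') Lc (j + 1))).submatrix (fun a : κ => ((pμ' a, Sum.inr (mμ' a)) : Idx M' (Fib d)))
        (fun b : ↥(pbox M') × Fin (d + 1) => ((b.1, Sum.inl b.2) : Idx M' (Fib d))))
    {𝔔₀ : Matrix κ (↥(pbox (fine Lc M')) × Fin (d + 1)) ℝ} (h𝔔₀ : Q₂₀ * Q₁₀ = 𝔔₀) :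
    (kkt H₀ (fromRows 𝔔₀ P)).det ≠ 0 := by
  rw [← h𝔔₀]
  exact torus_h0 M' hr hr' hM' j pμ' mμ' hfμ' hcoarse' hH₀ hQ₁₀ hτ₁ hτ₂ hD₁ hD₂ hP hQ₂₀

end Summit.QuantumFields.BalabanUV.Beta.FP.TorusOneShotInv

end
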